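import Literature.Analysis.OperatorTheory.Enflo2023.Lemma1
import HarnessLib

/-!
# Enflo (2023), Lemma 1: the lever `⟨T*u₁, u₀⟩` — what the choice of `u₁` must actually control

Source: P. H. Enflo, *On the invariant subspace problem in Hilbert spaces*, arXiv:2305.15442v2, p.7 (tex L392–L393:
"`u₁` is chosen such that `‖T*u₁‖ < (εθ)₀`"), p.8 (tex L399–L402: `εθ` "much smaller than" the Type-1 numbers `δ_k`)
and pp.8–9 (LEMMA 1) — a CLAIMED result under adjudication (b2b-enflo repair cell, formaliser 1); this file isolates the
quantity on which the printed Lemma 1 turns.  BLOCK-2b value: certificate / precise gap, not summit progress.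

Write `Tu₀ = n₀u₀ + m₁u₁ + g` with `g ⟂ u₀, u₁` (so `m₁ = ⟨u₁, Tu₀⟩ = conj⟨T*u₁, u₀⟩`, `|m₁| ≤ ‖T*u₁‖`).  For the
minimiser `ℓ'_ε = V_{y₀'} a` of (1) with `x₀ = (√3/2)u₀ + ½u₁`, `y₀' = (√3/2)u₀`, the Lagrange system (5) in the
coordinates `j = 0, 1` (`Vy.kkt_coord`) gives the LEVER IDENTITY
  `C'(a₁ − conj(n₀)a₀) = (√3/2)(conj(m₁)⟨u₁, x₀ − Va⟩ + ⟨g, x₀ − Va⟩)`      (`lever_identity`),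
and with `εθ = C'‖a‖²` ((6)), `|a_j| ≤ ‖a‖`, `⟨u₁, x₀ − Va⟩ = ½ − ⟨u₁, Va⟩`, `|⟨u₁, Va⟩| ≤ 0.872‖T*u₁‖‖a‖`:
  `(1 + |n₀|)·εθ ≥ (√3/2)‖a‖(|m₁|(½ − 0.872‖T*u₁‖‖a‖) − |⟨g, Va⟩|)`         (`etheta_lower_lever`).
Consequence (`printed_lemma1_fails_of_lever`): if `g = 0`, `|n₀| ≤ 1`, `‖T‖ ≤ 10⁻²⁰` and the lever is as large as
the printed choice allows up to a factor four, `|⟨u₁, Tu₀⟩| ≥ (εθ)₀/4` (compatible with `‖T*u₁‖ < (εθ)₀`), then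
`εθ(ℓ'_ε) ≥ 0.12|m₁| ≥ 0.03(εθ)₀ > ½·10⁻⁵(εθ)₀` at EVERY radius of the window `(½ − 10⁻⁵(εθ)₀, ½]`: the displayed conclusion
of Lemma 1 fails.  So the quantity Lemma 1 needs small is the single matrix coefficient `|⟨T*u₁, u₀⟩|`
(NECESSARY, up to garbage: `≲ 2·10⁻⁵(εθ)₀`), which the printed requirement `‖T*u₁‖ < (εθ)₀` does not control at
the `10⁻⁵` level; SUFFICIENT is `‖T*u₁‖ ≤ 1.25·10⁻⁶(εθ)₀` (`Lemma1.lemma1_repaired`).  This is the abstract form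
of the model refutations `Lemma1Model` / `Lemma1Standing` (there `n₀ = 0`, `m₁ = 10⁻²⁰`, `g = 0`) and the engine
of `Lemma1Regime` (the manuscript's regime `(εθ)₀ ≪ δ_k`).
Origin: planner-b2b-enflo-1-g11-0 (formaliser 1, gen 11), 2026-08-19.
-/

noncomputable section

open scoped InnerProductSpace ENNReal
open ContinuousLinearMap

namespace Literature.Analysis.OperatorTheory.Enflo2023

namespace Lemma1

open Vy

variable {H : Type*} [NormedAddCommGroup H] [InnerProductSpace ℂ H] [CompleteSpace H]

/-! ### The lever identity from (5) in the coordinates `j = 0, 1` -/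

/-- **Lever identity.**  If `Tu₀ = n₀u₀ + m₁u₁ + g` and `V†(x₀ − Va) = C'a` ((5)), then
`C'(a₁ − conj(n₀)a₀) = (√3/2)(conj(m₁)⟨u₁, x₀ − Va⟩ + ⟨g, x₀ − Va⟩)` — (5) at `j = 1` minus `conj(n₀)`·(5) at
`j = 0`. [cite: Enflo2023, v2 p.3 eq. (5), p.9 l.7–12] -/
theorem lever_identity (T : H →L[ℂ] H) (hT : ‖T‖ < 1) (u₀ u₁ g : H) (n₀ m₁ : ℂ)
    (hTu : T u₀ = n₀ • u₀ + m₁ • u₁ + g) (a : ℓ2) {C : ℝ}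
    (hC : adjoint (V T hT (yStart u₀)) (xStart u₀ u₁ - V T hT (yStart u₀) a) = (C : ℂ) • a) :
    (C : ℂ) * (a 1 - (starRingEnd ℂ) n₀ * a 0) =
      ((Real.sqrt 3 / 2 : ℝ) : ℂ) * ((starRingEnd ℂ) m₁ * ⟪u₁, xStart u₀ u₁ - V T hT (yStart u₀) a⟫_ℂ
        + ⟪g, xStart u₀ u₁ - V T hT (yStart u₀) a⟫_ℂ) := by
  set r := xStart u₀ u₁ - V T hT (yStart u₀) a with hr
  have h0 := kkt_coord T hT (yStart u₀) (xStart u₀ u₁) a hC 0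
  have h1 := kkt_coord T hT (yStart u₀) (xStart u₀ u₁) a hC 1
  rw [← hr, pow_zero, one_apply_eq_self, show yStart u₀ = ((Real.sqrt 3 / 2 : ℝ) : ℂ) • u₀ from rfl,
    inner_smul_left, Complex.conj_ofReal] at h0
  have hTy : T (yStart u₀) = ((Real.sqrt 3 / 2 : ℝ) : ℂ) • (n₀ • u₀ + m₁ • u₁ + g) := by
    rw [show yStart u₀ = ((Real.sqrt 3 / 2 : ℝ) : ℂ) • u₀ from rfl, map_smul, hTu]
  rw [← hr, pow_one, hTy, inner_smul_left, Complex.conj_ofReal, inner_add_left, inner_add_left,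
    inner_smul_left, inner_smul_left] at h1
  linear_combination (starRingEnd ℂ) n₀ * h0 - h1

/-- `|⟨u₁, V_{y₀'} a⟩| ≤ 0.872·‖T*u₁‖·‖a‖` for `‖T‖ ≤ 1/10` (`inner_u₁_V` and the operator-norm bound on `V`).
[cite: Enflo2023, v2 p.9, l.7–12] -/
lemma norm_inner_u₁_V_le (T : H →L[ℂ] H) (hT : ‖T‖ < 1) (hT10 : ‖T‖ ≤ 1 / 10) (u₀ u₁ : H)
    (hu₀ : ‖u₀‖ = 1) (h01 : ⟪u₀, u₁⟫_ℂ = 0) (a : ℓ2) :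
    ‖⟪u₁, V T hT (yStart u₀) a⟫_ℂ‖ ≤ 0.872 * ‖adjoint T u₁‖ * ‖a‖ := by
  have h4 : ‖⟪u₁, V T hT (yStart u₀) a⟫_ℂ‖ ≤ ‖adjoint T u₁‖ * ‖V T hT (yStart u₀) (L a)‖ := by
    rw [inner_u₁_V T hT u₀ u₁ h01 a]; exact norm_inner_le_norm _ _
  have h5 : ‖V T hT (yStart u₀) (L a)‖ ≤ 0.872 * ‖a‖ := by
    calc ‖V T hT (yStart u₀) (L a)‖ ≤ ‖V T hT (yStart u₀)‖ * ‖L a‖ := le_opNorm _ _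
      _ ≤ (Real.sqrt 3 / 2 * Real.sqrt (1 / (1 - ‖T‖ ^ 2))) * ‖a‖ := by
          have hV := norm_V_le T hT (yStart u₀)
          rw [norm_yStart u₀ hu₀] at hV
          exact mul_le_mul hV (norm_L_apply_le a) (norm_nonneg _) (by positivity)
      _ ≤ 0.872 * ‖a‖ := mul_le_mul_of_nonneg_right (opNorm_factor_le T hT10) (norm_nonneg _)
  have h6 : ‖adjoint T u₁‖ * ‖V T hT (yStart u₀) (L a)‖ ≤ ‖adjoint T u₁‖ * (0.872 * ‖a‖) :=
    mul_le_mul_of_nonneg_left h5 (norm_nonneg _)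
  linarith

/-- `‖V_{y₀'}‖ ≤ 0.872` for `‖T‖ ≤ 1/10`. [folklore] -/
lemma opNorm_V_yStart_le (T : H →L[ℂ] H) (hT : ‖T‖ < 1) (hT10 : ‖T‖ ≤ 1 / 10) (u₀ : H) (hu₀ : ‖u₀‖ = 1) :
    ‖V T hT (yStart u₀)‖ ≤ 0.872 := by
  have hV := norm_V_le T hT (yStart u₀)
  rw [norm_yStart u₀ hu₀] at hV
  exact hV.trans (opNorm_factor_le T hT10)

/-- Any vector feasible at a radius `ε ≤ ½` has `‖a‖ ≥ 0.573` (`‖Va‖ ≥ ‖x₀‖ − ε ≥ ½`, `‖V‖ ≤ 0.872`).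
[cite: Enflo2023, v2 p.8, Lemma 1 set-up] -/
lemma norm_ge_of_feasible (T : H →L[ℂ] H) (hT : ‖T‖ < 1) (hT10 : ‖T‖ ≤ 1 / 10) (u₀ u₁ : H)
    (hu₀ : ‖u₀‖ = 1) (hu₁ : ‖u₁‖ = 1) (h01 : ⟪u₀, u₁⟫_ℂ = 0) {ε : ℝ} (hε : ε ≤ 1 / 2) (a : ℓ2)
    (hfe : ‖xStart u₀ u₁ - V T hT (yStart u₀) a‖ ≤ ε) : 0.573 ≤ ‖a‖ := by
  have hx : ‖xStart u₀ u₁‖ = 1 := norm_xStart u₀ u₁ hu₀ hu₁ h01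
  have h1 : 1 / 2 ≤ ‖V T hT (yStart u₀) a‖ := by
    have := norm_sub_norm_le (xStart u₀ u₁) (V T hT (yStart u₀) a)
    rw [hx] at this; linarith
  have h2 : ‖V T hT (yStart u₀) a‖ ≤ 0.872 * ‖a‖ :=
    (le_opNorm _ _).trans (mul_le_mul_of_nonneg_right (opNorm_V_yStart_le T hT hT10 u₀ hu₀) (norm_nonneg _))
  nlinarith [norm_nonneg a]

/-! ### The lever lower bound on `εθ` -/

/-- **Lever lower bound.**  `Tu₀ = n₀u₀ + m₁u₁ + g`, `g ⟂ u₀, u₁`, `‖T‖ ≤ 1/10`, `ℓ'_ε = Va` the minimiser of (1)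
at a radius `ε ≤ ½`: `(1 + |n₀|)·εθ(ℓ'_ε) ≥ (√3/2)‖a‖(|m₁|(½ − 0.872‖T*u₁‖‖a‖) − |⟨g, Va⟩|)`.
[cite: Enflo2023, v2 p.3 eq. (5)–(6), p.9 l.7–12] -/
theorem etheta_lower_lever (T : H →L[ℂ] H) (hT : ‖T‖ < 1) (hT10 : ‖T‖ ≤ 1 / 10) (u₀ u₁ g : H)
    (hu₀ : ‖u₀‖ = 1) (hu₁ : ‖u₁‖ = 1) (h01 : ⟪u₀, u₁⟫_ℂ = 0) (n₀ m₁ : ℂ)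
    (hTu : T u₀ = n₀ • u₀ + m₁ • u₁ + g) (hg0 : ⟪g, u₀⟫_ℂ = 0) (hg1 : ⟪g, u₁⟫_ℂ = 0)
    {ε : ℝ} (hε : ε ≤ 1 / 2) (a : ℓ2) (ha : IsMinimal (V T hT (yStart u₀)) (xStart u₀ u₁) ε a) :
    Real.sqrt 3 / 2 * ‖a‖ *
        (‖m₁‖ * (1 / 2 - 0.872 * ‖adjoint T u₁‖ * ‖a‖) - ‖⟪g, V T hT (yStart u₀) a⟫_ℂ‖)
      ≤ (1 + ‖n₀‖) * (⟪xStart u₀ u₁ - V T hT (yStart u₀) a, V T hT (yStart u₀) a⟫_ℂ).re := by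
  have hx : ‖xStart u₀ u₁‖ = 1 := norm_xStart u₀ u₁ hu₀ hu₁ h01
  have ha0 : a ≠ 0 := ha.ne_zero (by rw [hx]; linarith)
  obtain ⟨C, hC0, hC⟩ := ha.kkt ha0
  have hlev := lever_identity T hT u₀ u₁ g n₀ m₁ hTu a hC
  set r := xStart u₀ u₁ - V T hT (yStart u₀) a with hr
  have h6 : (⟪r, V T hT (yStart u₀) a⟫_ℂ).re = C * ‖a‖ ^ 2 := by
    rw [hr, IsMinimal.eq6 hC, Complex.ofReal_re]
  have hu1r : ⟪u₁, r⟫_ℂ = (1 / 2 : ℂ) - ⟪u₁, V T hT (yStart u₀) a⟫_ℂ := by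
    rw [hr, inner_sub_right, inner_u₁_xStart u₀ u₁ hu₁ h01]
  have hgr : ⟪g, r⟫_ℂ = -⟪g, V T hT (yStart u₀) a⟫_ℂ := by
    rw [hr, inner_sub_right, xStart, inner_add_right, inner_smul_right, inner_smul_right, hg0, hg1]
    ring
  have hVa : ‖⟪u₁, V T hT (yStart u₀) a⟫_ℂ‖ ≤ 0.872 * ‖adjoint T u₁‖ * ‖a‖ :=
    norm_inner_u₁_V_le T hT hT10 u₀ u₁ hu₀ h01 a
  have hc0 : ‖a 0‖ ≤ ‖a‖ := lp.norm_apply_le_norm (by norm_num) a 0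
  have hc1 : ‖a 1‖ ≤ ‖a‖ := lp.norm_apply_le_norm (by norm_num) a 1
  -- the left side of the lever identity is at most `C'(1 + |n₀|)‖a‖`
  have hL : ‖(C : ℂ) * (a 1 - (starRingEnd ℂ) n₀ * a 0)‖ ≤ C * ((1 + ‖n₀‖) * ‖a‖) := by
    rw [norm_mul, Complex.norm_real, Real.norm_of_nonneg hC0]
    refine mul_le_mul_of_nonneg_left ?_ hC0
    calc ‖a 1 - (starRingEnd ℂ) n₀ * a 0‖ ≤ ‖a 1‖ + ‖(starRingEnd ℂ) n₀ * a 0‖ := norm_sub_le _ _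
      _ = ‖a 1‖ + ‖n₀‖ * ‖a 0‖ := by rw [norm_mul, RCLike.norm_conj]
      _ ≤ ‖a‖ + ‖n₀‖ * ‖a‖ := by gcongr
      _ = (1 + ‖n₀‖) * ‖a‖ := by ring
  -- the right side is at least `(√3/2)(|m₁|(½ − |⟨u₁,Va⟩|) − |⟨g,Va⟩|)`
  have hu1r' : 1 / 2 - ‖⟪u₁, V T hT (yStart u₀) a⟫_ℂ‖ ≤ ‖⟪u₁, r⟫_ℂ‖ := by
    rw [hu1r]
    have := norm_sub_norm_le (1 / 2 : ℂ) ⟪u₁, V T hT (yStart u₀) a⟫_ℂ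
    have h12 : ‖(1 / 2 : ℂ)‖ = 1 / 2 := by
      rw [show (1 / 2 : ℂ) = ((1 / 2 : ℝ) : ℂ) by push_cast; ring, Complex.norm_real]; norm_num
    linarith
  have hR : Real.sqrt 3 / 2 *
      (‖m₁‖ * (1 / 2 - 0.872 * ‖adjoint T u₁‖ * ‖a‖) - ‖⟪g, V T hT (yStart u₀) a⟫_ℂ‖) ≤
      ‖((Real.sqrt 3 / 2 : ℝ) : ℂ) * ((starRingEnd ℂ) m₁ * ⟪u₁, r⟫_ℂ + ⟪g, r⟫_ℂ)‖ := by
    rw [norm_mul, Complex.norm_real, Real.norm_of_nonneg (by positivity)]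
    refine mul_le_mul_of_nonneg_left ?_ (by positivity)
    have hA : ‖(starRingEnd ℂ) m₁ * ⟪u₁, r⟫_ℂ‖ = ‖m₁‖ * ‖⟪u₁, r⟫_ℂ‖ := by rw [norm_mul, RCLike.norm_conj]
    have hB : ‖⟪g, r⟫_ℂ‖ = ‖⟪g, V T hT (yStart u₀) a⟫_ℂ‖ := by rw [hgr, norm_neg]
    have htri : ‖(starRingEnd ℂ) m₁ * ⟪u₁, r⟫_ℂ‖ - ‖⟪g, r⟫_ℂ‖ ≤
        ‖(starRingEnd ℂ) m₁ * ⟪u₁, r⟫_ℂ + ⟪g, r⟫_ℂ‖ := by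
      have := norm_add_le ((starRingEnd ℂ) m₁ * ⟪u₁, r⟫_ℂ + ⟪g, r⟫_ℂ) (-⟪g, r⟫_ℂ)
      rw [add_neg_cancel_right, norm_neg] at this
      linarith
    have hm : ‖m₁‖ * (1 / 2 - 0.872 * ‖adjoint T u₁‖ * ‖a‖) ≤ ‖m₁‖ * ‖⟪u₁, r⟫_ℂ‖ :=
      mul_le_mul_of_nonneg_left (by linarith) (norm_nonneg _)
    linarith
  have heq : ‖(C : ℂ) * (a 1 - (starRingEnd ℂ) n₀ * a 0)‖ =
      ‖((Real.sqrt 3 / 2 : ℝ) : ℂ) * ((starRingEnd ℂ) m₁ * ⟪u₁, r⟫_ℂ + ⟪g, r⟫_ℂ)‖ := by rw [hlev]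
  have hmain : Real.sqrt 3 / 2 *
      (‖m₁‖ * (1 / 2 - 0.872 * ‖adjoint T u₁‖ * ‖a‖) - ‖⟪g, V T hT (yStart u₀) a⟫_ℂ‖) ≤
      C * ((1 + ‖n₀‖) * ‖a‖) := by linarith
  have := mul_le_mul_of_nonneg_right hmain (norm_nonneg a)
  calc Real.sqrt 3 / 2 * ‖a‖ *
        (‖m₁‖ * (1 / 2 - 0.872 * ‖adjoint T u₁‖ * ‖a‖) - ‖⟪g, V T hT (yStart u₀) a⟫_ℂ‖)
      = Real.sqrt 3 / 2 *
        (‖m₁‖ * (1 / 2 - 0.872 * ‖adjoint T u₁‖ * ‖a‖) - ‖⟪g, V T hT (yStart u₀) a⟫_ℂ‖) * ‖a‖ := by ring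
    _ ≤ C * ((1 + ‖n₀‖) * ‖a‖) * ‖a‖ := this
    _ = (1 + ‖n₀‖) * (C * ‖a‖ ^ 2) := by ring
    _ = (1 + ‖n₀‖) * (⟪r, V T hT (yStart u₀) a⟫_ℂ).re := by rw [h6]

/-! ### A competitor: the window is reachable with `‖a‖ ≤ 1 + (1 + |n₀|)·(2/√3)w/|m₁|` when `g = 0` -/

/-- **Competitor.**  If `Tu₀ = n₀u₀ + m₁u₁` with `m₁ ≠ 0`, the coefficient vector `b = (1 − c·n₀, c, 0, …)`,
`c = τ·conj(m₁)/|m₁|²`, `τ = 2w/√3`, has `V b = (√3/2)u₀ + w·u₁`, hence `‖x₀ − Vb‖ = ½ − w` and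
`‖b‖ ≤ 1 + (1 + |n₀|)τ/|m₁|`: every minimiser at a radius `≥ ½ − w` has norm at most that.
[cite: Enflo2023, v2 p.8, Lemma 1 set-up ("‖ℓ'_{0.5}‖ ≤ 1")] -/
theorem norm_minimal_le_of_lever (T : H →L[ℂ] H) (hT : ‖T‖ < 1) (u₀ u₁ : H)
    (hu₁ : ‖u₁‖ = 1) (n₀ m₁ : ℂ) (hm : m₁ ≠ 0)
    (hTu : T u₀ = n₀ • u₀ + m₁ • u₁) {w ε : ℝ} (hw0 : 0 ≤ w) (hw : w ≤ 1 / 2) (hε : 1 / 2 - w ≤ ε)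
    (a : ℓ2) (ha : IsMinimal (V T hT (yStart u₀)) (xStart u₀ u₁) ε a) :
    ‖a‖ ≤ 1 + (1 + ‖n₀‖) * (2 * w / Real.sqrt 3 / ‖m₁‖) := by
  have hs3 := sqrt3_half_bounds
  have hs0 : (0 : ℝ) < Real.sqrt 3 := by nlinarith [hs3.1]
  have hm0 : (0 : ℝ) < ‖m₁‖ := norm_pos_iff.2 hm
  have hmC : ((‖m₁‖ : ℝ) : ℂ) ≠ 0 := by exact_mod_cast hm0.ne'
  -- τ = 2w/√3, c = τ·conj(m₁)/|m₁|²
  obtain ⟨τ, hτ⟩ : ∃ τ : ℝ, τ = 2 * w / Real.sqrt 3 := ⟨_, rfl⟩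
  have hτ0 : 0 ≤ τ := by rw [hτ]; positivity
  have hτw : τ * (Real.sqrt 3 / 2) = w := by rw [hτ]; field_simp
  obtain ⟨c, hc⟩ : ∃ c : ℂ, c = ((τ / ‖m₁‖ ^ 2 : ℝ) : ℂ) * (starRingEnd ℂ) m₁ := ⟨_, rfl⟩
  have hcm : c * m₁ = (τ : ℂ) := by
    rw [hc, mul_assoc, Complex.conj_mul']
    push_cast
    field_simp
  have hcn : ‖c‖ = τ / ‖m₁‖ := by
    rw [hc, norm_mul, Complex.norm_real, Real.norm_of_nonneg (by positivity), RCLike.norm_conj]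
    field_simp
  obtain ⟨b, hb⟩ : ∃ b : ℓ2, b = (1 - c * n₀) • lp.single 2 0 (1 : ℂ) + c • lp.single 2 1 (1 : ℂ) :=
    ⟨_, rfl⟩
  have hVb : V T hT (yStart u₀) b = yStart u₀ + ((τ * (Real.sqrt 3 / 2) : ℝ) : ℂ) • u₁ := by
    rw [hb, map_add, map_smul, map_smul, V_single, V_single, pow_zero, pow_one, one_apply_eq_self,
      show yStart u₀ = ((Real.sqrt 3 / 2 : ℝ) : ℂ) • u₀ from rfl, map_smul, hTu]
    push_cast
    rw [← hcm]
    match_scalars <;> ring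
  have hfe : b ∈ feasible (V T hT (yStart u₀)) (xStart u₀ u₁) ε := by
    rw [mem_feasible, hVb, ← sub_sub, xStart_sub_yStart, ← sub_smul, ← Complex.ofReal_sub, norm_smul,
      Complex.norm_real, hu₁, mul_one, hτw, Real.norm_of_nonneg (by linarith)]
    exact hε
  have hbn : ‖b‖ ≤ ‖1 - c * n₀‖ + ‖c‖ := by
    rw [hb]
    refine (norm_add_le _ _).trans (le_of_eq ?_)
    rw [norm_smul, norm_smul, lp.norm_single (by norm_num), lp.norm_single (by norm_num), norm_one, mul_one,
      mul_one]
  have h1c : ‖1 - c * n₀‖ ≤ 1 + ‖c‖ * ‖n₀‖ := by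
    calc ‖1 - c * n₀‖ ≤ ‖(1 : ℂ)‖ + ‖c * n₀‖ := norm_sub_le _ _
      _ = 1 + ‖c‖ * ‖n₀‖ := by rw [norm_one, norm_mul]
  calc ‖a‖ ≤ ‖b‖ := ha.norm_le hfe
    _ ≤ (1 + ‖c‖ * ‖n₀‖) + ‖c‖ := by linarith
    _ = 1 + (1 + ‖n₀‖) * (τ / ‖m₁‖) := by rw [hcn]; ring
    _ = 1 + (1 + ‖n₀‖) * (2 * w / Real.sqrt 3 / ‖m₁‖) := by rw [hτ]

/-! ### The printed Lemma 1 fails whenever the lever is of the order of `(εθ)₀` -/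

/-- **Printed Lemma 1 fails when `|⟨u₁, Tu₀⟩| ≥ (εθ)₀/4`.**  `‖T‖ ≤ 10⁻²⁰`, `u₀ ⟂ u₁` unit, `Tu₀ = n₀u₀ + m₁u₁`
with `|n₀| ≤ 1`, `0 < (εθ)₀ ≤ 4|m₁|` (so `(εθ)₀ ≤ 4‖T‖`): at EVERY radius `ε ∈ (½ − 10⁻⁵(εθ)₀, ½]` the minimiser
`ℓ'_ε` has `εθ(ℓ'_ε) > ½·10⁻⁵(εθ)₀` (indeed `≥ 0.12|m₁| ≥ 0.03(εθ)₀`).  The printed requirement on `u₁` (`‖T*u₁‖ < (εθ)₀`,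
p.7) allows `|⟨u₁, Tu₀⟩| = |⟨T*u₁, u₀⟩|` anywhere in `[0, (εθ)₀)`. [cite: Enflo2023, v2 p.7 (choice of u₁), pp.8–9 Lemma 1] -/
theorem printed_lemma1_fails_of_lever (T : H →L[ℂ] H) (hT : ‖T‖ < 1) (hT20 : ‖T‖ ≤ 1 / 10 ^ 20)
    (u₀ u₁ : H) (hu₀ : ‖u₀‖ = 1) (hu₁ : ‖u₁‖ = 1) (h01 : ⟪u₀, u₁⟫_ℂ = 0) (n₀ m₁ : ℂ) (hn₀ : ‖n₀‖ ≤ 1)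
    (hTu : T u₀ = n₀ • u₀ + m₁ • u₁) {e₀ : ℝ} (he : 0 < e₀) (hm : e₀ ≤ 4 * ‖m₁‖) :
    ∀ (ε : ℝ) (a : ℓ2), 1 / 2 - e₀ / 10 ^ 5 < ε → ε ≤ 1 / 2 →
      IsMinimal (V T hT (yStart u₀)) (xStart u₀ u₁) ε a →
        e₀ / (2 * 10 ^ 5) < (⟪xStart u₀ u₁ - V T hT (yStart u₀) a, V T hT (yStart u₀) a⟫_ℂ).re := by
  intro ε a hε1 hε2 ha
  have hT10 : ‖T‖ ≤ 1 / 10 := hT20.trans (by norm_num)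
  have hm0 : (0 : ℝ) < ‖m₁‖ := by linarith
  have hm1 : m₁ ≠ 0 := norm_pos_iff.1 hm0
  have hmT : ‖m₁‖ ≤ 1 / 10 ^ 20 := by
    -- `|m₁| = |⟨u₁, Tu₀⟩| ≤ ‖T‖`
    have h10 : ⟪u₁, u₀⟫_ℂ = 0 := by rw [← inner_conj_symm, h01, map_zero]
    have h11 : ⟪u₁, u₁⟫_ℂ = 1 := by rw [inner_self_eq_norm_sq_to_K, hu₁]; norm_num
    have hin : ⟪u₁, T u₀⟫_ℂ = m₁ := by
      rw [hTu, inner_add_right, inner_smul_right, inner_smul_right, h10, h11, mul_zero, zero_add, mul_one]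
    calc ‖m₁‖ = ‖⟪u₁, T u₀⟫_ℂ‖ := by rw [hin]
      _ ≤ ‖u₁‖ * ‖T u₀‖ := norm_inner_le_norm _ _
      _ ≤ 1 * (‖T‖ * ‖u₀‖) := by rw [hu₁]; exact mul_le_mul_of_nonneg_left (T.le_opNorm u₀) zero_le_one
      _ ≤ 1 / 10 ^ 20 := by rw [hu₀, one_mul, mul_one]; exact hT20
  have he20 : e₀ ≤ 4 / 10 ^ 20 := by linarith
  -- upper bound on ‖a‖ from the competitor (w = 10⁻⁵ e₀)
  have hB := norm_minimal_le_of_lever T hT u₀ u₁ hu₁ n₀ m₁ hm1 hTu (w := e₀ / 10 ^ 5)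
      (by positivity) (by linarith) hε1.le a ha
  have hs3 := sqrt3_half_bounds
  have hs0 : (0 : ℝ) < Real.sqrt 3 := by nlinarith [hs3.1]
  have hratio : 2 * (e₀ / 10 ^ 5) / Real.sqrt 3 / ‖m₁‖ ≤ 8 / 10 ^ 5 / Real.sqrt 3 := by
    rw [div_le_iff₀ hm0]
    have : 2 * (e₀ / 10 ^ 5) / Real.sqrt 3 ≤ 8 / 10 ^ 5 / Real.sqrt 3 * ‖m₁‖ := by
      rw [div_mul_eq_mul_div, div_le_div_iff_of_pos_right hs0]; linarith
    exact this
  have h83 : 8 / 10 ^ 5 / Real.sqrt 3 ≤ 5 / 10 ^ 5 := by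
    rw [div_le_iff₀ hs0]; nlinarith [hs3.1]
  have hB' : ‖a‖ ≤ 1.0001 := by
    have : (1 + ‖n₀‖) * (2 * (e₀ / 10 ^ 5) / Real.sqrt 3 / ‖m₁‖) ≤ 2 * (5 / 10 ^ 5) := by
      calc (1 + ‖n₀‖) * (2 * (e₀ / 10 ^ 5) / Real.sqrt 3 / ‖m₁‖) ≤ 2 * (8 / 10 ^ 5 / Real.sqrt 3) := by
            refine mul_le_mul (by linarith) hratio (by positivity) (by norm_num)
        _ ≤ 2 * (5 / 10 ^ 5) := by linarith
    linarith
  -- lower bound on ‖a‖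
  have hA : 0.573 ≤ ‖a‖ := norm_ge_of_feasible T hT hT10 u₀ u₁ hu₀ hu₁ h01 hε2 a ha.norm_sub_le
  -- the lever bound with g = 0
  have hTu' : T u₀ = n₀ • u₀ + m₁ • u₁ + 0 := by rw [hTu, add_zero]
  have hlev := etheta_lower_lever T hT hT10 u₀ u₁ 0 hu₀ hu₁ h01 n₀ m₁ hTu' (inner_zero_left _)
    (inner_zero_left _) hε2 a ha
  rw [inner_zero_left, norm_zero, sub_zero] at hlev
  have hadj : ‖adjoint T u₁‖ ≤ 1 / 10 ^ 20 := (norm_adjoint_apply_le_opNorm T u₁ hu₁).trans hT20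
  set θ := (⟪xStart u₀ u₁ - V T hT (yStart u₀) a, V T hT (yStart u₀) a⟫_ℂ).re
  -- numeric assembly: (√3/2)·0.573·|m₁|·(½ − 10⁻²⁰·0.88) ≤ 2θ, |m₁| ≥ e₀/4
  have h1 : 0.872 * ‖adjoint T u₁‖ * ‖a‖ ≤ 1 / 10 ^ 20 := by
    calc 0.872 * ‖adjoint T u₁‖ * ‖a‖ ≤ 0.872 * (1 / 10 ^ 20) * 1.0001 := by
          refine mul_le_mul (mul_le_mul_of_nonneg_left hadj (by norm_num)) hB' (norm_nonneg _) (by positivity)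
      _ ≤ 1 / 10 ^ 20 := by norm_num
  have h2 : Real.sqrt 3 / 2 * ‖a‖ * (‖m₁‖ * (1 / 2 - 0.872 * ‖adjoint T u₁‖ * ‖a‖)) ≥
      0.866 * 0.573 * (‖m₁‖ * (1 / 2 - 1 / 10 ^ 20)) := by
    have hx : ‖m₁‖ * (1 / 2 - 1 / 10 ^ 20) ≤ ‖m₁‖ * (1 / 2 - 0.872 * ‖adjoint T u₁‖ * ‖a‖) :=
      mul_le_mul_of_nonneg_left (by linarith) hm0.le
    have hy : 0.866 * 0.573 ≤ Real.sqrt 3 / 2 * ‖a‖ :=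
      mul_le_mul (by linarith [hs3.1]) hA (by norm_num) (by linarith [hs3.1])
    have hz : 0 ≤ ‖m₁‖ * (1 / 2 - 1 / 10 ^ 20) := mul_nonneg hm0.le (by norm_num)
    calc 0.866 * 0.573 * (‖m₁‖ * (1 / 2 - 1 / 10 ^ 20))
        ≤ Real.sqrt 3 / 2 * ‖a‖ * (‖m₁‖ * (1 / 2 - 1 / 10 ^ 20)) := mul_le_mul_of_nonneg_right hy hz
      _ ≤ Real.sqrt 3 / 2 * ‖a‖ * (‖m₁‖ * (1 / 2 - 0.872 * ‖adjoint T u₁‖ * ‖a‖)) :=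
          mul_le_mul_of_nonneg_left hx (by positivity)
  have h3 : (1 + ‖n₀‖) * θ ≤ 2 * θ := by
    have hθ0 : 0 ≤ θ := by
      have ha0 : a ≠ 0 := ha.ne_zero (by rw [norm_xStart u₀ u₁ hu₀ hu₁ h01]; linarith)
      obtain ⟨C, hC0, hC⟩ := ha.kkt ha0
      exact IsMinimal.etheta_nonneg hC0 hC
    nlinarith
  nlinarith [h2, hlev, h3, hm, he]

end Lemma1

end Literature.Analysis.OperatorTheory.Enflo2023
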